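import Summits.CriticalPhenomena.CardyFormulaZ2.Theorems.CardyComplexConeParafermionToSLESixFamiliesDiamondDefsR4
import Summits.CriticalPhenomena.CardyFormulaZ2.Theorems.CardyComplexConeParafermionToSLESixFamiliesDiamondTraceSideCore
import Summits.CriticalPhenomena.CardyFormulaZ2.Theorems.CardyComplexConeParafermionToSLESixFamiliesDiamondTraceBulkArcs
import Mathlib.Analysis.Convex.Topology
import HarnessLib

/-!
# S1‴ `stub_exactPotentialTracePh3`: the phase-anchored boundary trace of the exact potential on marked diamonds,
# assembled from the boundary dart phases and the connectivity of the discrete arcs (line `potential-darboux-picard-diamond`)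

Crux `ParafermionToSLESixFamilies` (stmt-CriticalPhenomena-11389), route `CardyComplexCone`, line
`potential-darboux-picard-diamond`, stub S1‴ of skeleton r4:
`stub_exactPotentialTracePh3 : BoundaryDartPhase → DiamondArcsConnected → ExactPotentialTracePh`.

`ExactPotentialTracePh` (`…DiamondDefs.lean` §4) asks, along every admissible family `Λ` of a marked diamond `D`, for
(E) exact pairs eventually — `eventually_exists_isExactPair` (p138726); a direction function `τ` with (τ-NORM)/(TURN) —
`diamondTau`, `norm_diamondTau`, `diamondTau_turn` (p144600); a unit anchor `u δ` — the one of `BoundaryDartPhase`; and the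
two metric clauses, here with constants `C = 10`, `c₁ = 1/2`:
(DIR) for every oriented boundary segment `[p, q]` and trim `η`, eventually in `δ`, the renormalised face-potential increment
between two side cells ordered along the segment is within `10 δ^{2/3}` of the ray `ℝ≥0 · u δ τ(p,q)`; (LOW) on free segments
the progress along that ray dominates half the renormalised touch mass strictly between the cells, up to `10 δ^{2/3}`.

This file is the `∀ᶠ δ` gluing of the per-mesh, per-side core `dir_low_free_of_chart'` / `dir_wired_of_chart`
(`…DiamondTraceSideCore.lean`): a boundary segment lies in one arc (`segment_subset_arc_of_isBdrySegment`: the open segment is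
connected in `arc 0 ∪ arc 1` and misses the marks) and on one side `k` of the frame (`segData_of_isBdrySegment`); in the frame
`exp(-iπ/4)·sideFrame k` (chart `layerFn (k+2)`, `layerFn (k+3)`, last layer `n`) the eventual inputs — admissibility,
`Ω_δ ⊇` the lattice points of the diamond (`eventually_mem_meshDomain_of_isMarkedDiamond`), the arcs near the segment
(`eventually_arcs_near_freeSegment` / `…wiredSegment`), the dart phases (`BoundaryDartPhase` at trim `η/4`), (H1)/(H2)
(`DiamondArcsConnected`), and `δ < min (η/40) (min α β/4)` — are exactly the chart hypotheses of the core
(`near_segment_of_chart` converts the chart window back to the segment).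
-/

noncomputable section

namespace Summit.CriticalPhenomena.CardyFormulaZ2.Cruxes.ParafermionToSLESixFamilies.PotentialDarbouxPicardDiamond

open scoped Topology BigOperators
open Filter Set Metric Complex MeasureTheory
open Literature.Probability Literature.Probability.LatticeModels Literature.Probability.Percolation
open Literature.Probability.LatticeModels.DiscreteDobrushin
open Literature.Probability.RandomPlanarGeometry
open Summit.CriticalPhenomena.CardyFormulaZ2.Cruxes.ParafermionToSLESixFamilies.IicTraceFluxPairing

/-! ## A boundary segment lies in one arc -/

/-- **An oriented boundary segment of a Dobrushin domain lies in one of the two boundary arcs**: the open segment is a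
connected subset of `arc 0 ∪ arc 1` missing both marks (the only common points of the two closed arcs), so it lies in one
arc, and so does its closure, the segment. -/
theorem segment_subset_arc_of_isBdrySegment (D : DobrushinDomain) {p q : ℂ} (h : IsBdrySegment D p q) :
    segment ℝ p q ⊆ D.arc 0 ∨ segment ℝ p q ⊆ D.arc 1 := by
  obtain ⟨_, hfr, h0, h1, -⟩ := h
  have hcover : openSegment ℝ p q ⊆ D.arc 0 ∪ D.arc 1 := by
    intro z hz
    have hz' : z ∈ frontier D.carrier := hfr (openSegment_subset_segment ℝ p q hz)
    rw [← D.iUnion_arc_holds] at hz'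
    obtain ⟨i, hi⟩ := mem_iUnion.1 hz'
    fin_cases i
    · exact Or.inl hi
    · exact Or.inr hi
  have hdisj : openSegment ℝ p q ∩ (D.arc 0 ∩ D.arc 1) = ∅ := by
    refine Set.eq_empty_iff_forall_notMem.2 fun z ⟨hz, hz0, hz1⟩ => ?_
    rcases D.mem_arc_inter_arc (i := 0) (k := 1) (by decide) hz0 hz1 with rfl | rfl
    · exact h0 hz
    · exact h1 hz
  have hconn : IsPreconnected (openSegment ℝ p q) := (convex_openSegment p q).isPreconnected
  rcases (isPreconnected_iff_subset_of_disjoint_closed.1 hconn) _ _ (D.isClosed_arc 0) (D.isClosed_arc 1) hcover hdisj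
    with hs | hs
  · left
    rw [← closure_openSegment (𝕜 := ℝ) p q]
    exact closure_minimal hs (D.isClosed_arc 0)
  · right
    rw [← closure_openSegment (𝕜 := ℝ) p q]
    exact closure_minimal hs (D.isClosed_arc 1)

/-! ## From the chart window back to the segment -/

/-- **A site of the layers `n − m … n` whose ordinate lies `η`-inside the window of `[p, q]` is within `(m+1)δ` of the
segment and `η`-away from `p` and `q`** (frame form: `p, q` on the side line `re = a`, ordinates `Yp < Yq`). -/
theorem near_segment_of_chart {c e : ℂ} (he : ‖e‖ = 1) {δ : ℝ} (hδ : 0 < δ) {p q : ℂ} {a Yp Yq : ℝ}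
    (hpX : ((p - c) * e).re = a) (hqX : ((q - c) * e).re = a) (hpY : ((p - c) * e).im = Yp) (hqY : ((q - c) * e).im = Yq)
    (hpq : Yp < Yq) {j : Fin 4} {X₀ : ℝ} (hX : ∀ x : Site 2, ((meshPoint δ x - c) * e).re = Real.sqrt 2 / 2 * δ * layerFn j x + X₀)
    {n : ℤ} (hn : Real.sqrt 2 / 2 * δ * n + X₀ < a) (hn' : a ≤ Real.sqrt 2 / 2 * δ * (n + 1) + X₀) {η : ℝ} (hη : 0 ≤ η)
    (x : Site 2) (m : ℕ) (hm : n - m ≤ layerFn j x) (hm' : layerFn j x ≤ n) (hY1 : Yp + η ≤ ((meshPoint δ x - c) * e).im)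
    (hY2 : ((meshPoint δ x - c) * e).im ≤ Yq - η) :
    infDist (meshPoint δ x) (segment ℝ p q) ≤ (m + 1) * δ ∧ η ≤ dist (meshPoint δ x) p ∧ η ≤ dist (meshPoint δ x) q := by
  have hh : Real.sqrt 2 / 2 * δ ≤ δ := by
    have hs2 : Real.sqrt 2 < 1.415 := by rw [Real.sqrt_lt' (by norm_num)]; norm_num
    nlinarith
  have hpos : 0 ≤ Real.sqrt 2 / 2 * δ := by positivity
  refine ⟨?_, ?_, ?_⟩
  · refine (infDist_segment_le_abs_re he hpX hqX hpY hqY hpq (by linarith) (by linarith)).trans ?_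
    rw [hX, abs_le]
    have h1 : ((n : ℝ) - m) ≤ layerFn j x := by exact_mod_cast hm
    have h2 : (layerFn j x : ℝ) ≤ n := by exact_mod_cast hm'
    have hm0 : (0 : ℝ) ≤ m := Nat.cast_nonneg m
    have e1 : Real.sqrt 2 / 2 * δ * ((n : ℝ) - m) ≤ Real.sqrt 2 / 2 * δ * layerFn j x := mul_le_mul_of_nonneg_left h1 hpos
    have e2 : Real.sqrt 2 / 2 * δ * (layerFn j x : ℝ) ≤ Real.sqrt 2 / 2 * δ * n := mul_le_mul_of_nonneg_left h2 hpos
    have e3 : Real.sqrt 2 / 2 * δ * (m : ℝ) ≤ δ * m := mul_le_mul_of_nonneg_right hh hm0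
    constructor <;> nlinarith
  · linarith [abs_im_sub_le_dist_p he hpY (meshPoint δ x), le_abs_self (((meshPoint δ x - c) * e).im - Yp)]
  · linarith [abs_im_sub_le_dist_q he hqY (meshPoint δ x), neg_abs_le (((meshPoint δ x - c) * e).im - Yq)]

/-! ## The gluing along one side -/

section Glue

variable {D : DobrushinDomain} {c : ℂ} {α β : ℝ} (hα : 0 < α) (hβ : 0 < β)
  (hcar : D.carrier = {z | |((z - c) * exp (-(Real.pi / 4 : ℝ) * I)).re| < α ∧ |((z - c) * exp (-(Real.pi / 4 : ℝ) * I)).im| < β})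
  {Λ : ℝ → DiscreteDobrushin} (hΛ : IsFamily D Λ) {u : ℝ → ℂ} (hu : ∀ δ : ℝ, ‖u δ‖ = 1)
  (hconn : ∀ᶠ δ in 𝓝[>] (0:ℝ), ((discreteDomainGraph D.carrier δ).induce (Λ δ).zdArcA).Preconnected ∧
      ((zdGraph 2).induce (Λ δ).zdArcB).Preconnected)

/-- **The chart of side `k` at mesh `δ`**: the frame `e′ = exp(-iπ/4)·sideFrame k` is unimodular, the carrier is the
tilted rectangle of `e′` with half-widths `sideHalfWidth`, `sideHalfLength`, and the lattice coordinates are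
`(δ/√2)·layerFn (k+2) + X₀` across, `(δ/√2)·layerFn (k+2+1) + Y₀` along, with a last inside layer `n`. -/
theorem exists_sideChart (c : ℂ) (α β : ℝ) (k : Fin 4) {δ : ℝ} (hδ : 0 < δ) : ∃ (e' : ℂ) (X₀ Y₀ : ℝ) (n : ℤ),
    e' = exp (-(Real.pi / 4 : ℝ) * I) * sideFrame k ∧ ‖e'‖ = 1 ∧
    {z : ℂ | |((z - c) * exp (-(Real.pi / 4 : ℝ) * I)).re| < α ∧ |((z - c) * exp (-(Real.pi / 4 : ℝ) * I)).im| < β} =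
      {z : ℂ | |((z - c) * e').re| < sideHalfWidth α β k ∧ |((z - c) * e').im| < sideHalfLength α β k} ∧
    (∀ x : Site 2, ((meshPoint δ x - c) * e').re = Real.sqrt 2 / 2 * δ * layerFn (k + 2) x + X₀) ∧
    (∀ x : Site 2, ((meshPoint δ x - c) * e').im = Real.sqrt 2 / 2 * δ * layerFn (k + 2 + 1) x + Y₀) ∧
    Real.sqrt 2 / 2 * δ * n + X₀ < sideHalfWidth α β k ∧ sideHalfWidth α β k ≤ Real.sqrt 2 / 2 * δ * (n + 1) + X₀ := by
  obtain ⟨X₀, hX⟩ := exists_re_tilt_sideFrame_eq_layerFn δ c k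
  obtain ⟨Y₀, hY⟩ := exists_im_tilt_sideFrame_eq_layerFn δ c k
  obtain ⟨n, hn, hn'⟩ := exists_lastLayer (X₀ := X₀) (a := sideHalfWidth α β k) (show 0 < Real.sqrt 2 / 2 * δ by positivity)
  refine ⟨_, X₀, Y₀, n, rfl, ?_, carrier_sideFrame c _ α β k, hX, fun x => ?_, hn, hn'⟩
  · rw [norm_mul, norm_exp_neg_pi_div_four_mul_I, norm_sideFrame, mul_one]
  · rw [fin4_add_two_add_one]; exact hY x

include hα hβ hcar hΛ hu hconn in
/-- **(DIR) and (LOW) along one FREE boundary segment, eventually in the mesh.** For an oriented boundary segment `[p, q]` of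
the marked diamond on the free arc, a trim `η > 0`, and the free dart phases of `BoundaryDartPhase` at trim `η/4` along
`[p, q]`: eventually in `δ`, for every exact pair of `Λ δ` and side cells `f, f′` with `proj f ≤ proj f′`, the (DIR) inequality
(direction `u δ · τ(p,q)`, `C = 10`) and the (LOW) inequality (`c₁ = 1/2`, `C = 10`) hold. -/
theorem eventually_dir_low_free {p q : ℂ} (hpq : IsBdrySegment D p q) (hsub : segment ℝ p q ⊆ D.arc 1) {η : ℝ} (hη : 0 < η)
    (hph : ∀ᶠ δ in 𝓝[>] (0:ℝ), ∀ (hδ : (Λ δ).IsZdAdmissible) (x : Site 2) (j : Fin 4),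
      infDist (meshPoint δ x) (segment ℝ p q) ≤ 3 * δ → η / 4 ≤ dist (meshPoint δ x) p → η / 4 ≤ dist (meshPoint δ x) q →
      (Λ δ).IsInnerFace (faceAt x j) → x ∉ (Λ δ).zdArcB → x + cornerUnit (j + 1) ∈ (Λ δ).zdArcB → x + cornerUnit (j + 2) ∈ (Λ δ).zdArcB →
      ∀ (ω : BondConfig (Site 2)) (t : ℕ), t < exitTime hδ ω →
        cornerOrbit ((Λ δ).bcBondConfig ω) (startCorner hδ) t = (x, j) →
        Complex.exp (-(Real.pi / 6 * turnCount ((Λ δ).bcBondConfig ω) (startCorner hδ) t : ℝ) * I) * I ^ (j : ℕ) *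
            Complex.exp (((-(Real.pi / 6) : ℝ) : ℂ) * I) = u δ * diamondTau c α β (D.pt 0) (D.pt 1) p q) :
    ∀ᶠ δ in 𝓝[>] (0:ℝ), ∀ Φ Ψ : Site 2 → ℂ, IsExactPair (Λ δ) δ Φ Ψ → ∀ f f' : Site 2, f ∈ sideCells (Λ δ) δ p q η →
      f' ∈ sideCells (Λ δ) δ p q η → proj p q (ctr δ f) ≤ proj p q (ctr δ f') →
      rayDist (u δ * diamondTau c α β (D.pt 0) (D.pt 1) p q) (((δ ^ ((2:ℝ) / 3) : ℝ) : ℂ) * (Ψ f' - Ψ f)) ≤ 10 * δ ^ ((2:ℝ) / 3) ∧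
      1 / 2 * touchMass (Λ δ) δ p q (proj p q (ctr δ f) + 3 * δ) (proj p q (ctr δ f') - 3 * δ) - 10 * δ ^ ((2:ℝ) / 3) ≤
        ((starRingEnd ℂ) (u δ * diamondTau c α β (D.pt 0) (D.pt 1) p q) * (((δ ^ ((2:ℝ) / 3) : ℝ) : ℂ) * (Ψ f' - Ψ f))).re := by
  obtain ⟨k, s, t, hs, hst, ht, hP, hQ⟩ := segData_of_isBdrySegment hα hβ hcar hpq
  have hL := two_mul_sideHalfLength α β k
  have hw := min_le_sideHalfWidth α β k
  have hD : IsMarkedDiamond D := ⟨c, α, β, hα, hβ, hcar⟩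
  have hsmall : ∀ᶠ δ in 𝓝[>] (0:ℝ), 0 < δ ∧ δ < min (η / 40) (min α β / 4) := by
    filter_upwards [Ioo_mem_nhdsGT (lt_min (by positivity) (by positivity) : (0:ℝ) < min (η / 40) (min α β / 4))] with δ hδ
    exact hδ
  filter_upwards [eventually_mem_meshDomain_of_isMarkedDiamond D hD, hΛ.2.2.2.2.2,
    eventually_arcs_near_freeSegment D Λ hΛ p q hpq hsub (η / 4) (by positivity), hph, hconn, hsmall]
    with δ hgood hE harc hphδ hconnδ hsm Φ Ψ hPair f f' hf hf' hle
  obtain ⟨hδ, hδ1⟩ := hsm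
  have hδη : 40 * δ ≤ η := by have := lt_of_lt_of_le hδ1 (min_le_left _ _); linarith
  have hδw : 4 * δ ≤ sideHalfWidth α β k := by have := lt_of_lt_of_le hδ1 (min_le_right _ _); linarith
  -- the chart of the side at mesh `δ`
  obtain ⟨e', X₀, Y₀, n, he'def, he', hbox, hX, hY, hn, hn'⟩ := exists_sideChart c α β k hδ
  have hΩE : (Λ δ).Ω = D.carrier := hΛ.1 δ
  have hEδ : (Λ δ).δ = δ := hΛ.2.1 δ
  have hΩ' : (Λ δ).Ω = {z : ℂ | |((z - c) * e').re| < sideHalfWidth α β k ∧ |((z - c) * e').im| < sideHalfLength α β k} := by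
    rw [hΩE, hcar]; exact hbox
  have hgood' : ∀ x : Site 2, meshPoint δ x ∈ (Λ δ).Ω → x ∈ meshDomain (Λ δ).Ω δ := by rw [hΩE]; exact hgood
  have hpe : (p - c) * e' = dParam α β k s * sideFrame k := by rw [he'def, ← mul_assoc]; exact congrArg (· * _) hP
  have hqe : (q - c) * e' = dParam α β k t * sideFrame k := by rw [he'def, ← mul_assoc]; exact congrArg (· * _) hQ
  have hpX : ((p - c) * e').re = sideHalfWidth α β k := by rw [hpe, re_dParam_mul_sideFrame]
  have hqX : ((q - c) * e').re = sideHalfWidth α β k := by rw [hqe, re_dParam_mul_sideFrame]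
  have hpY : ((p - c) * e').im = -sideHalfLength α β k + s := by rw [hpe, im_dParam_mul_sideFrame]
  have hqY : ((q - c) * e').im = -sideHalfLength α β k + t := by rw [hqe, im_dParam_mul_sideFrame]
  have hYpq : -sideHalfLength α β k + s < -sideHalfLength α β k + t := by linarith
  have hconn1 : ((discreteDomainGraph (Λ δ).Ω (Λ δ).δ).induce (Λ δ).zdArcA).Preconnected := by rw [hΩE, hEδ]; exact hconnδ.1
  obtain ⟨d, hd_def⟩ : ∃ d : ℂ, d = u δ * diamondTau c α β (D.pt 0) (D.pt 1) p q := ⟨_, rfl⟩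
  have hd : ‖d‖ = 1 := by rw [hd_def, norm_mul, hu, norm_diamondTau, mul_one]
  have key := dir_low_free_of_chart' he' hδ hδw hΩ' hEδ hE hgood' hX hY hn hn' hpX hqX hpY hqY hYpq (by linarith) (by linarith)
    hδη (fun x hA1 hA2 hY1 hY2 => ?_) hd (fun x hA hY1 hY2 hinner hxB hb1 hb2 ω t' ht horb => ?_) hconn1 hconnδ.2 hPair hf hf' hle
  · rw [hd_def] at key; exact key
  · obtain ⟨hd6, hp4, hq4⟩ := near_segment_of_chart he' hδ hpX hqX hpY hqY hYpq hX hn hn' (by positivity : (0:ℝ) ≤ η / 4) x 4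
      (by push_cast; omega) hA2 (by linarith) (by linarith)
    exact harc x (by push_cast at hd6; linarith) hp4 hq4
  · obtain ⟨hd6, hp4, hq4⟩ := near_segment_of_chart he' hδ hpX hqX hpY hqY hYpq hX hn hn' (by positivity : (0:ℝ) ≤ η / 4) x 2
      (by push_cast; omega) (by omega) (by linarith) (by linarith)
    have h3 : infDist (meshPoint δ x) (segment ℝ p q) ≤ 3 * δ := by push_cast at hd6; linarith
    have := hphδ hE x (k + 2) h3 hp4 hq4 hinner hxB hb1 hb2 ω t' ht horb
    rw [← hd_def] at this
    exact this

include hα hβ hcar hΛ hu in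
/-- **(DIR) along one WIRED boundary segment, eventually in the mesh.** For an oriented boundary segment `[p, q]` of the
marked diamond on the wired arc, a trim `η > 0`, and the wired dart phases of `BoundaryDartPhase` at trim `η/4` along `[p, q]`:
eventually in `δ`, for every exact pair of `Λ δ` and side cells `f, f′` with `proj f ≤ proj f′`, the (DIR) inequality
(direction `u δ · τ(p,q)`, `C = 10`) holds. -/
theorem eventually_dir_wired {p q : ℂ} (hpq : IsBdrySegment D p q) (hsub : segment ℝ p q ⊆ D.arc 0) {η : ℝ} (hη : 0 < η)
    (hph : ∀ᶠ δ in 𝓝[>] (0:ℝ), ∀ (hδ : (Λ δ).IsZdAdmissible) (a : Site 2) (j : Fin 4),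
      infDist (meshPoint δ a) (segment ℝ p q) ≤ 3 * δ → η / 4 ≤ dist (meshPoint δ a) p → η / 4 ≤ dist (meshPoint δ a) q →
      (Λ δ).IsInnerFace (faceAt a j) → a ∈ (Λ δ).zdArcA → a + cornerUnit (j + 1) ∈ (Λ δ).zdArcA → a + cornerUnit (j + 2) ∈ (Λ δ).zdArcA →
      ∀ (ω : BondConfig (Site 2)) (t : ℕ), t < exitTime hδ ω →
        cornerOrbit ((Λ δ).bcBondConfig ω) (startCorner hδ) t = (a, j) →
        Complex.exp (-(Real.pi / 6 * turnCount ((Λ δ).bcBondConfig ω) (startCorner hδ) t : ℝ) * I) * I ^ (j : ℕ) *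
            Complex.exp (((Real.pi / 6 : ℝ)) * I) = u δ * diamondTau c α β (D.pt 0) (D.pt 1) p q) :
    ∀ᶠ δ in 𝓝[>] (0:ℝ), ∀ Φ Ψ : Site 2 → ℂ, IsExactPair (Λ δ) δ Φ Ψ → ∀ f f' : Site 2, f ∈ sideCells (Λ δ) δ p q η →
      f' ∈ sideCells (Λ δ) δ p q η → proj p q (ctr δ f) ≤ proj p q (ctr δ f') →
      rayDist (u δ * diamondTau c α β (D.pt 0) (D.pt 1) p q) (((δ ^ ((2:ℝ) / 3) : ℝ) : ℂ) * (Ψ f' - Ψ f)) ≤ 10 * δ ^ ((2:ℝ) / 3) := by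
  obtain ⟨k, s, t, hs, hst, ht, hP, hQ⟩ := segData_of_isBdrySegment hα hβ hcar hpq
  have hL := two_mul_sideHalfLength α β k
  have hw := min_le_sideHalfWidth α β k
  have hD : IsMarkedDiamond D := ⟨c, α, β, hα, hβ, hcar⟩
  have hsmall : ∀ᶠ δ in 𝓝[>] (0:ℝ), 0 < δ ∧ δ < min (η / 40) (min α β / 4) := by
    filter_upwards [Ioo_mem_nhdsGT (lt_min (by positivity) (by positivity) : (0:ℝ) < min (η / 40) (min α β / 4))] with δ hδ
    exact hδ
  filter_upwards [eventually_mem_meshDomain_of_isMarkedDiamond D hD, hΛ.2.2.2.2.2,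
    eventually_arcs_near_wiredSegment hΛ hpq hsub (by positivity : (0:ℝ) < η / 4), hph, hsmall]
    with δ hgood hE harc hphδ hsm Φ Ψ hPair f f' hf hf' hle
  obtain ⟨hδ, hδ1⟩ := hsm
  have hδη : 40 * δ ≤ η := by have := lt_of_lt_of_le hδ1 (min_le_left _ _); linarith
  have hδw : 4 * δ ≤ sideHalfWidth α β k := by have := lt_of_lt_of_le hδ1 (min_le_right _ _); linarith
  obtain ⟨e', X₀, Y₀, n, he'def, he', hbox, hX, hY, hn, hn'⟩ := exists_sideChart c α β k hδ
  have hΩE : (Λ δ).Ω = D.carrier := hΛ.1 δ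
  have hEδ : (Λ δ).δ = δ := hΛ.2.1 δ
  have hΩ' : (Λ δ).Ω = {z : ℂ | |((z - c) * e').re| < sideHalfWidth α β k ∧ |((z - c) * e').im| < sideHalfLength α β k} := by
    rw [hΩE, hcar]; exact hbox
  have hgood' : ∀ x : Site 2, meshPoint δ x ∈ (Λ δ).Ω → x ∈ meshDomain (Λ δ).Ω δ := by rw [hΩE]; exact hgood
  have hpe : (p - c) * e' = dParam α β k s * sideFrame k := by rw [he'def, ← mul_assoc]; exact congrArg (· * _) hP
  have hqe : (q - c) * e' = dParam α β k t * sideFrame k := by rw [he'def, ← mul_assoc]; exact congrArg (· * _) hQ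
  have hpX : ((p - c) * e').re = sideHalfWidth α β k := by rw [hpe, re_dParam_mul_sideFrame]
  have hqX : ((q - c) * e').re = sideHalfWidth α β k := by rw [hqe, re_dParam_mul_sideFrame]
  have hpY : ((p - c) * e').im = -sideHalfLength α β k + s := by rw [hpe, im_dParam_mul_sideFrame]
  have hqY : ((q - c) * e').im = -sideHalfLength α β k + t := by rw [hqe, im_dParam_mul_sideFrame]
  have hYpq : -sideHalfLength α β k + s < -sideHalfLength α β k + t := by linarith
  obtain ⟨d, hd_def⟩ : ∃ d : ℂ, d = u δ * diamondTau c α β (D.pt 0) (D.pt 1) p q := ⟨_, rfl⟩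
  have hd : ‖d‖ = 1 := by rw [hd_def, norm_mul, hu, norm_diamondTau, mul_one]
  have key := dir_wired_of_chart he' hδ hδw hΩ' hΩE hEδ hE hgood' hX hY hn hn' hpX hqX hpY hqY hYpq (by linarith) (by linarith)
    hδη (fun x hA1 hA2 hY1 hY2 => ?_) hd (fun a hA hY1 hY2 hinner haA ha1 ha2 ω t' ht horb => ?_) hPair hf hf' hle
  · rw [hd_def] at key; exact key
  · obtain ⟨hd6, hp4, hq4⟩ := near_segment_of_chart he' hδ hpX hqX hpY hqY hYpq hX hn hn' (by positivity : (0:ℝ) ≤ η / 4) x 4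
      (by push_cast; omega) hA2 (by linarith) (by linarith)
    exact harc x (by push_cast at hd6; linarith) hp4 hq4
  · obtain ⟨hd6, hp4, hq4⟩ := near_segment_of_chart he' hδ hpX hqX hpY hqY hYpq hX hn hn' (by positivity : (0:ℝ) ≤ η / 4) a 1
      (by push_cast; omega) (by omega) (by linarith) (by linarith)
    have h3 : infDist (meshPoint δ a) (segment ℝ p q) ≤ 3 * δ := by push_cast at hd6; linarith
    have := hphδ hE a (k + 2) h3 hp4 hq4 hinner haA ha1 ha2 ω t' ht horb
    rw [← hd_def] at this
    exact this

end Glue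

/-! ## The stub -/

/-- **S1‴ — the phase-anchored boundary trace of the exact potential on marked diamonds** (stub
`stub_exactPotentialTracePh3` of line `potential-darboux-picard-diamond`): the boundary dart phases (`BoundaryDartPhase`)
and the eventual connectivity of the discrete arcs (`DiamondArcsConnected`) imply `ExactPotentialTracePh`, with
`τ = diamondTau`, the anchor `u` of `BoundaryDartPhase`, `C = 10` and `c₁ = 1/2`. -/
theorem stub_exactPotentialTracePh3 : BoundaryDartPhase → DiamondArcsConnected → ExactPotentialTracePh := by
  intro hPhase hConn D hD Λ hΛ
  refine ⟨eventually_exists_isExactPair D Λ hΛ, ?_⟩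
  have hconn := hConn D hD Λ hΛ
  obtain ⟨c, α, β, hα, hβ, hcar⟩ := hD
  obtain ⟨u, hu, hph⟩ := hPhase D c α β hα hβ hcar Λ hΛ
  -- the dart phases, specialised to the two arcs
  have hph1 : ∀ p q : ℂ, IsBdrySegment D p q → segment ℝ p q ⊆ D.arc 1 → ∀ η : ℝ, 0 < η →
      ∀ᶠ δ in 𝓝[>] (0:ℝ), ∀ (hδ : (Λ δ).IsZdAdmissible) (x : Site 2) (j : Fin 4),
      infDist (meshPoint δ x) (segment ℝ p q) ≤ 3 * δ → η / 4 ≤ dist (meshPoint δ x) p → η / 4 ≤ dist (meshPoint δ x) q →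
      (Λ δ).IsInnerFace (faceAt x j) → x ∉ (Λ δ).zdArcB → x + cornerUnit (j + 1) ∈ (Λ δ).zdArcB → x + cornerUnit (j + 2) ∈ (Λ δ).zdArcB →
      ∀ (ω : BondConfig (Site 2)) (t : ℕ), t < exitTime hδ ω →
        cornerOrbit ((Λ δ).bcBondConfig ω) (startCorner hδ) t = (x, j) →
        Complex.exp (-(Real.pi / 6 * turnCount ((Λ δ).bcBondConfig ω) (startCorner hδ) t : ℝ) * I) * I ^ (j : ℕ) *
            Complex.exp (((-(Real.pi / 6) : ℝ) : ℂ) * I) = u δ * diamondTau c α β (D.pt 0) (D.pt 1) p q := by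
    intro p q hpq hsub η hη
    filter_upwards [hph 1 p q hpq hsub (η / 4) (by positivity)] with δ h hE x j hd hp hq hin hxB hb1 hb2 ω t ht horb
    have key := h hE x j hd hp hq hin (fun _ => ⟨hxB, hb1, hb2⟩) (fun h0 => absurd h0 (by decide)) ω t ht horb
    rw [if_pos (rfl : (1 : Fin 2) = 1)] at key
    exact key
  have hph0 : ∀ p q : ℂ, IsBdrySegment D p q → segment ℝ p q ⊆ D.arc 0 → ∀ η : ℝ, 0 < η →
      ∀ᶠ δ in 𝓝[>] (0:ℝ), ∀ (hδ : (Λ δ).IsZdAdmissible) (a : Site 2) (j : Fin 4),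
      infDist (meshPoint δ a) (segment ℝ p q) ≤ 3 * δ → η / 4 ≤ dist (meshPoint δ a) p → η / 4 ≤ dist (meshPoint δ a) q →
      (Λ δ).IsInnerFace (faceAt a j) → a ∈ (Λ δ).zdArcA → a + cornerUnit (j + 1) ∈ (Λ δ).zdArcA → a + cornerUnit (j + 2) ∈ (Λ δ).zdArcA →
      ∀ (ω : BondConfig (Site 2)) (t : ℕ), t < exitTime hδ ω →
        cornerOrbit ((Λ δ).bcBondConfig ω) (startCorner hδ) t = (a, j) →
        Complex.exp (-(Real.pi / 6 * turnCount ((Λ δ).bcBondConfig ω) (startCorner hδ) t : ℝ) * I) * I ^ (j : ℕ) *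
            Complex.exp (((Real.pi / 6 : ℝ)) * I) = u δ * diamondTau c α β (D.pt 0) (D.pt 1) p q := by
    intro p q hpq hsub η hη
    filter_upwards [hph 0 p q hpq hsub (η / 4) (by positivity)] with δ h hE a j hd hp hq hin haA ha1 ha2 ω t ht horb
    have key := h hE a j hd hp hq hin (fun h1 => absurd h1 (by decide)) (fun _ => ⟨haA, ha1, ha2⟩) ω t ht horb
    rw [if_neg (show (0 : Fin 2) ≠ 1 by decide)] at key
    exact key
  refine ⟨diamondTau c α β (D.pt 0) (D.pt 1), u, 10, 1 / 2, by norm_num, hu, fun p q _ => norm_diamondTau _ _ _ _ _ _ _,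
    fun p v q h1 h2 => diamondTau_turn hα hβ hcar h1 h2, ?_, ?_⟩
  · intro p q hpq η hη
    rcases segment_subset_arc_of_isBdrySegment D hpq with hsub | hsub
    · exact eventually_dir_wired hα hβ hcar hΛ hu hpq hsub hη (hph0 p q hpq hsub η hη)
    · filter_upwards [eventually_dir_low_free hα hβ hcar hΛ hu hconn hpq hsub hη (hph1 p q hpq hsub η hη)]
        with δ hδ Φ Ψ hP f f' hf hf' hle
      exact (hδ Φ Ψ hP f f' hf hf' hle).1
  · intro p q hpq hsub η hη
    filter_upwards [eventually_dir_low_free hα hβ hcar hΛ hu hconn hpq hsub hη (hph1 p q hpq hsub η hη)]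
      with δ hδ Φ Ψ hP f f' hf hf' hle
    exact (hδ Φ Ψ hP f f' hf hf' hle).2

end Summit.CriticalPhenomena.CardyFormulaZ2.Cruxes.ParafermionToSLESixFamilies.PotentialDarbouxPicardDiamond

end
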